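import Mathlib
import Summits.Ventures.PercRepro2.RBDefs
import Summits.Ventures.PercRepro2.RBRoot
import Summits.Ventures.PercRepro2.RBRootDefs
import Summits.Ventures.PercRepro2.RBRootEdge
import Summits.Ventures.PercRepro2.RBRootEdgePin
import Summits.Ventures.PercRepro2.RBRootEdgeMain
import Summits.Ventures.PercRepro2.RBRootEdgeT
import Summits.Ventures.PercRepro2.RBRootIsolated
import Summits.Ventures.PercRepro2.RBTwoMarkers
import Summits.Ventures.PercRepro2.RBTwoMarkersMain
import Summits.Ventures.PercRepro2.RBTwoMarkersCross
import Summits.Ventures.PercRepro2.RBTwoMarkersCrossMain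
import Summits.Ventures.PercRepro2.RBKernel
import Summits.Ventures.PercRepro2.RBParallel
import Summits.Ventures.PercRepro2.RBKernelDefs
import Summits.Ventures.PercRepro2.RBLeaf
import Summits.Ventures.PercRepro2.RBPruneDefs
import Summits.Ventures.PercRepro2.RBKernelLeaf
import Summits.Ventures.PercRepro2.RBSeries
import Summits.Ventures.PercRepro2.RBSeriesMain
import Summits.Ventures.PercRepro2.RBSeriesMass
import Summits.Ventures.PercRepro2.RBSeriesKernel
import Summits.Ventures.PercRepro2.RBReduceDefs

/-!
# The typed row 2′RB on every skeleton-reducible weight vector (mine-a g5; MINE-A.md §25, §33–§36)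

`RB.RBcross_and_RBsame_of_reducible`: `IsProbVec p → Reducible ends s t b o w p →
RBcross p ends o b s t w ∧ RBsame p ends o b s t w`. Each reduction step preserves both forms
exactly (`RBcross_and_RBsame_prune_iff`, `RBcross_and_RBsame_merge_iff`,
`RBSeries.RBcross_and_RBsame_series_iff`) and the kernel class is `RBcross_and_RBsame_of_nbhd'`.
In words: the typed row holds at every vertex `w` of every finite graph whose marked skeleton
(unmarked pendant trees pruned, parallel edges merged, unmarked degree-2 vertices suppressed) has
`N(w) ⊆ {s, t, b, o}` — the class of MINE-A.md §32 (b) in full.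
-/

namespace Summit.Ventures.PercRepro2

namespace RB

open scoped Classical

variable {V : Type*} {E : Type*} [Fintype E] [DecidableEq E] [Fintype V] [DecidableEq V]
  {R : Type*} [Field R] [LinearOrder R] [IsStrictOrderedRing R]

omit [DecidableEq V] [IsStrictOrderedRing R] in
/-- **Merging a parallel pair preserves both forms exactly.** -/
theorem RBcross_and_RBsame_merge_iff {p : E → R} (ends : E → Sym2 V) (o b s t w : V) {e e' : E}
    (hne : e ≠ e') (hpar : ends e = ends e') :
    (RBcross p ends o b s t w ∧ RBsame p ends o b s t w) ↔
      (RBcross (Function.update (Function.update p e (p e + p e' - p e * p e')) e' 0) ends o b s t w ∧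
        RBsame (Function.update (Function.update p e (p e + p e' - p e * p e')) e' 0) ends o b s t w) := by
  obtain ⟨m1, m2⟩ := RBParallel.prob_merge_parallel_conn ends s t p hne hpar b s
  obtain ⟨m3, -⟩ := RBParallel.prob_merge_parallel_conn ends s t p hne hpar o t
  obtain ⟨m4, -⟩ := RBParallel.prob_merge_parallel_conn ends s t p hne hpar o s
  unfold RBcross RBsame Qst
  rw [rbSum_eq_rbRoot, rbSum_eq_rbRoot, rbSum_eq_rbRoot, rbSum_eq_rbRoot,
    RBParallel.rbSum_merge_parallel ends s t w p hne hpar b s o t,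
    RBParallel.rbSum_merge_parallel ends s t w p hne hpar b s o s, m1, m2, m3, m4]

omit [DecidableEq V] in
/-- **The typed row on every skeleton-reducible weight vector.** -/
theorem RBcross_and_RBsame_of_reducible {p : E → R} (hp : IsProbVec p) (ends : E → Sym2 V)
    (o b s t w : V) (hr : Reducible ends s t b o w p) :
    RBcross p ends o b s t w ∧ RBsame p ends o b s t w := by
  induction hr with
  | kernel p H => exact RBcross_and_RBsame_of_nbhd' hp ends o b s t w H
  | prune p f u v hends hvu hus hut hub huo huw huniq _ ih =>
    exact (RBcross_and_RBsame_prune_iff ends o b s t w hends hvu hus hut hub huo huw huniq).2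
      (ih (hp.update f le_rfl zero_le_one))
  | merge p e e' hne hpar _ ih =>
    exact (RBcross_and_RBsame_merge_iff ends o b s t w hne hpar).2
      (ih (RBParallel.isProbVec_merge hp e e'))
  | series p e₀ f₁ f₂ u v₁ v₂ hends₀ hends₁ hends₂ hv₁ hv₂ h12 h01 h02 huniq hus hut hub huo huw _ ih =>
    refine (RBSeries.RBcross_and_RBsame_series_iff hp ends o b s t w u hends₀ hends₁ hends₂ hv₁ hv₂
      h12 h01 h02 huniq hus hut hub huo huw).2 (ih ?_)
    refine ((hp.update e₀ ?_ ?_).update f₁ le_rfl zero_le_one).update f₂ le_rfl zero_le_one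
    · nlinarith [hp.nonneg e₀, hp.le_one e₀, mul_nonneg (hp.nonneg f₁) (hp.nonneg f₂)]
    · nlinarith [hp.nonneg e₀, hp.le_one e₀, mul_nonneg (hp.nonneg f₁) (hp.nonneg f₂),
        mul_le_one₀ (hp.le_one f₁) (hp.nonneg f₂) (hp.le_one f₂)]

end RB

end Summit.Ventures.PercRepro2
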